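import Summits.QuantumFields.BalabanUV.Beta.D1BFx.DressedTadpoleTable

/-!
# `BalabanUV.Beta.D1BFx.ReducedKernelSandwich` — road «BF-x» for binder row D1, leaf A4 (part 4, the END of the leaf): THE WHOLE
# REDUCED ONE-SHOT KERNEL IS AN `ℋ`-SANDWICH OF AN EXPLICIT BLOCK-PERIODIC FINE HESSIAN KERNEL —
# `TOfRed n a S (tableRed n Wf) μ ν z = dressedEntryP (wK n) (fineHess n a S Wf) (n•(−z)) μ ν`,
# `fineHess = ½·tadpole-table − ½·bubble-table`; hence (K-R5) `n⁸ · Σ'_z z_κ z_λ TOfRed … μ ν z = avgM2 n (fineHess μ ν) κ λ` GIVEN the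
# per-entry Ward row sums and parity first moments of `fineHess`: the dressing cross terms `X_n` of node R5 VANISH for the reduced kernel

HONEST FRAMING (cell contract, verbatim): «discharging `BetaPertH` makes Bałaban's UV stability UNCONDITIONAL — a real
constructive-QFT result; it is NOT the continuum limit and NOT the Clay problem.»  One definition with a body ([our object] `fineHess`) and
[folklore] bookkeeping composed BY NAME from parts 1–3 of this leaf and K-R5.  HYPOTHESES THAT STAY HYPOTHESES (named, never minted):
`Spr (Ga n a)` (T1's decay binder); the SYMMETRY of the fine second-order table `Wf κ′ u λ′ u′ = Wf λ′ u′ κ′ u` (a Hessian table is symmetric —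
T5 delivers it); the per-entry ROW SUMS `Σ_{s′} fineHess κ′ λ′ b s′ = 0` (`hrow`: THE WARD IDENTITY of the gauge-invariant piece in
kernel form — node A3.b / an2's Lemma W; NOT proved here) and the base-point-summed FIRST MOMENTS (`hT1`: reflection parity, node R5 (T1);
NOT proved here).  Nothing of the manuscripts under audit is asserted or cited; nothing of D1 / BetaPertH is discharged.  Value = kernel
bookkeeping leaf of road BF-x (skeleton `HOME/beta/skeletons/D1-b2b-balaban-beta-d1-p2.md` v1.4 nodes R4/R5/A4/A7), NOT summit progress;
NOT continuum, NOT Clay.  HONEST DEPENDENCY (verbatim): continuum YM on T⁴ ⇐ BetaPertH ∧ nine spine estimates (0/9 proved); BetaPertH ⇐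
(D1) ∧ (D4) ∧ CAP+tail; G-an2-4 gates asym, D1 and NE2/3/4.

CONTENT: §1 `absMoment₂_add'`, `dressedEntryP_add` (additivity of the sandwich in the fine kernel, for block-periodic summable entries);
§2 [our object] `fineHess`; `isBlockPeriodic_fineHess`, `absMoment₂_baseKer_fineHess`, `fineHess_transpose` (matrix symmetry);
§3 **`tadpolePart_eq_dressedEntryP`**, **`TOfRed_tableRed_eq_dressedEntryP`**; §4 **`bondSecondMoment_TOfRed_eq_avgM2`**, `secondMoment_TOfRed_eq`.
-/

noncomputable section

namespace Summit.QuantumFields.BalabanUV.Beta.D1BFx.ReducedKernelSandwich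

open Finset
open scoped BigOperators
open Literature.MathematicalPhysics.QuantumFieldTheory.Balaban1983to89
open Literature.MathematicalPhysics.QuantumFieldTheory.Balaban1983to89.Beta
open B12Sec2to5 (l1 l1_nonneg)
open ExpKernelCalculus (Site MKer Decays BiLoc comp tr bubble tadpole hessKer shiftK)
open DecimatedMoment (cosetInd)
open DecimatedMomentSummable (AbsMoment₂)
open DressedMomentNormalisation (EKer resSite)
open KernelSpecInstance (wH)
open MinimiserIdentityForm (wK absMoment₂_wK)
open OneStepResolventKernel (wsum)
open Summit.QuantumFields.BalabanUV.Beta.TameKernelCalculus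
open Summit.QuantumFields.BalabanUV.Beta.D1BFx.GluonLeg (Ga)
open Summit.QuantumFields.BalabanUV.Beta.D1BFx.ReducedKernel (StencilR vertexRed TOfRed)
open Summit.QuantumFields.BalabanUV.Beta.D1BFx.DressedBubbleTable (bubbleTable bubbleTable_apply isBlockPeriodic_bubbleTable
  absMoment₂_baseKer_bubbleTable bubbleTable_transpose bubblePart_eq_dressedEntryP)
open Summit.QuantumFields.BalabanUV.Beta.D1BFx.DressedTadpoleTable (Table₂R tableRed tadpoleTable tadpoleTable_apply
  isBlockPeriodic_tadpoleTable absMoment₂_baseKer_tadpoleTable tadpole_tableRed)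
open Summit.QuantumFields.BalabanUV.Beta.D1BFx.MomentTransferPeriodic (Ker₂ IsBlockPeriodic baseKer)
open Summit.QuantumFields.BalabanUV.Beta.D1BFx.MomentTransferPeriodicSum (dressedSumP periodicMajorant absMoment₂_periodicMajorant
  abs_baseKer_le_periodicMajorant summable_dressedP_fibre)
open Summit.QuantumFields.BalabanUV.Beta.D1BFx.MomentTransferPeriodicEntry (EKer₂ dressedEntryP avgM2
  bondSecondMomentP_solutionOp_four)

/-! ## §1 Additivity of the sandwich in the fine kernel -/

section Add

variable {d N : ℕ}

/-- [folklore] `AbsMoment₂` is additive. -/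
theorem absMoment₂_add' {f g : (Fin d → ℤ) → ℝ} (hf : AbsMoment₂ f) (hg : AbsMoment₂ g) : AbsMoment₂ (fun t => f t + g t) := by
  refine Summable.of_nonneg_of_le (fun t => mul_nonneg (by positivity) (abs_nonneg _)) (fun t => ?_) (hf.add hg)
  rw [← mul_add]
  exact mul_le_mul_of_nonneg_left (abs_add_le _ _) (by positivity)

/-- [folklore] **THE SANDWICH IS ADDITIVE IN THE FINE KERNEL** for block-periodic entries with absolutely summable base-point kernels and a
dressing with absolutely summable entries (each fibre series converges absolutely, `MomentTransferPeriodicSum.summable_dressedP_fibre`). -/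
theorem dressedEntryP_add (hN : 0 < N) (w : EKer d) (P Q : EKer₂ d) (hw : ∀ κ l, AbsMoment₂ (w κ l))
    (hP : ∀ c e, IsBlockPeriodic N (P c e)) (hQ : ∀ c e, IsBlockPeriodic N (Q c e))
    (hPA : ∀ c e b, AbsMoment₂ (baseKer (P c e) b)) (hQA : ∀ c e b, AbsMoment₂ (baseKer (Q c e) b))
    (y : Fin d → ℤ) (a b : Fin d) :
    dressedEntryP w (fun c e s s' => P c e s s' + Q c e s s') y a b = dressedEntryP w P y a b + dressedEntryP w Q y a b := by
  simp only [dressedEntryP, dressedSumP, ← Finset.sum_add_distrib]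
  refine Finset.sum_congr rfl fun c _ => Finset.sum_congr rfl fun e _ => ?_
  have hsP := summable_dressedP_fibre (hw c a) (absMoment₂_periodicMajorant (hPA c e)) (hw e b)
    (abs_baseKer_le_periodicMajorant hN (hP c e)) y
  have hsQ := summable_dressedP_fibre (hw c a) (absMoment₂_periodicMajorant (hQA c e)) (hw e b)
    (abs_baseKer_le_periodicMajorant hN (hQ c e)) y
  rw [← hsP.tsum_add hsQ]
  exact tsum_congr fun p => by ring

end Add

/-! ## §2 The fine Hessian kernel of the reduced piece -/

variable (n : ℕ) [NeZero n] (a : ℝ)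

/-- [our object] **THE FINE HESSIAN KERNEL** of the reduced piece: `fineHess n a S Wf κ′ λ′ u u′ := ½·tadpole (Ga) (Wf κ′ u λ′ u′) −
½·bubble (Ga) (S κ′ u) (S λ′ u′)` (= `tadpoleTable + bubbleTable` entrywise).  A DEFINITION. -/
def fineHess (S : StencilR) (Wf : Table₂R) : EKer₂ 4 :=
  fun κ' l' u u' => tadpoleTable n a Wf κ' l' u u' + bubbleTable n a S κ' l' u u'

/-- [our object] Unfolding. -/
theorem fineHess_apply (S : StencilR) (Wf : Table₂R) (κ' l' : Fin 4) (u u' : Site 4) :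
    fineHess n a S Wf κ' l' u u' = tadpoleTable n a Wf κ' l' u u' + bubbleTable n a S κ' l' u u' := rfl

variable {S : StencilR} {Wf : Table₂R} {Cs C2 δ : ℝ}

/-- [folklore] Block periodicity of the fine Hessian kernel. -/
theorem isBlockPeriodic_fineHess (hn : 1 ≤ n)
    (hScov : ∀ (κ' : Fin 4) (u v : Site 4), S κ' (u + v) = shiftK (-v) (S κ' u))
    (hWcov : ∀ (κ' : Fin 4) (u : Site 4) (l' : Fin 4) (u' v : Site 4), Wf κ' (u + v) l' (u' + v) = shiftK (-v) (Wf κ' u l' u'))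
    (κ' l' : Fin 4) : IsBlockPeriodic n (fineHess n a S Wf κ' l') := fun t s s' => by
  simp only [fineHess_apply, isBlockPeriodic_tadpoleTable n a hn hWcov κ' l' t s s', isBlockPeriodic_bubbleTable n a hn hScov κ' l' t s s']

/-- [folklore] Absolutely summable base-point kernels of the fine Hessian kernel. -/
theorem absMoment₂_baseKer_fineHess (hGa : Spr (Ga n a)) (hS : ∀ κ' u, BiLoc (S κ' u) u u Cs δ)
    (hW : ∀ κ' u l' u', BiLoc (Wf κ' u l' u') u u' C2 δ) (hδ : 0 < δ) (κ' l' : Fin 4) (b : Site 4) :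
    AbsMoment₂ (baseKer (fineHess n a S Wf κ' l') b) :=
  absMoment₂_add' (absMoment₂_baseKer_tadpoleTable n a hGa hW hδ κ' l' b) (absMoment₂_baseKer_bubbleTable n a hGa hS hδ κ' l' b)

/-- [folklore] MATRIX SYMMETRY of the fine Hessian kernel (`fineHess κ′λ′ u u′ = fineHess λ′κ′ u′ u`) for a SYMMETRIC fine table. -/
theorem fineHess_transpose (hGa : Spr (Ga n a)) (hS : ∀ κ' u, BiLoc (S κ' u) u u Cs δ) (hδ : 0 < δ)
    (hWsymm : ∀ (κ' : Fin 4) (u : Site 4) (l' : Fin 4) (u' : Site 4), Wf κ' u l' u' = Wf l' u' κ' u)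
    (κ' l' : Fin 4) (u u' : Site 4) : fineHess n a S Wf κ' l' u u' = fineHess n a S Wf l' κ' u' u := by
  simp only [fineHess_apply, tadpoleTable_apply]
  rw [hWsymm κ' u l' u', bubbleTable_transpose n a hGa hS hδ κ' l' u u']

/-! ## §3 The reduced kernel as a sandwich -/

/-- [folklore] **THE TADPOLE PART OF `TOfRed` IS THE SANDWICH OF THE TADPOLE TABLE**:
`½·tadpole (Ga) (tableRed Wf μ 0 ν z) = dressedEntryP (wK n) (tadpoleTable n a Wf) (n•(−z)) μ ν`. -/
theorem tadpolePart_eq_dressedEntryP (hn : 1 ≤ n) (hGa : Spr (Ga n a)) (hW : ∀ κ' u l' u', BiLoc (Wf κ' u l' u') u u' C2 δ)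
    (hδ : 0 < δ)
    (hWcov : ∀ (κ' : Fin 4) (u : Site 4) (l' : Fin 4) (u' v : Site 4), Wf κ' (u + v) l' (u' + v) = shiftK (-v) (Wf κ' u l' u'))
    (μ ν : Fin 4) (z : Site 4) :
    (1 / 2 : ℝ) * tadpole (Ga n a) (tableRed n Wf μ 0 ν z) = dressedEntryP (wK n) (tadpoleTable n a Wf) ((n : ℤ) • (-z)) μ ν := by
  rw [tadpole_tableRed n a hGa hW hδ μ 0 ν z, Finset.mul_sum]
  simp only [dressedEntryP, dressedSumP]
  refine Finset.sum_congr rfl fun κ' _ => ?_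
  rw [Finset.mul_sum]
  refine Finset.sum_congr rfl fun l' _ => ?_
  rw [← tsum_mul_left]
  rw [← (Equiv.prodCongr (Equiv.refl (Site 4)) (Equiv.addRight ((n : ℤ) • z))).tsum_eq]
  refine tsum_congr fun q => ?_
  obtain ⟨u, x⟩ := q
  simp only [Equiv.prodCongr_apply, Prod.map_apply, Equiv.refl_apply, Equiv.coe_addRight, smul_zero, sub_zero,
    add_sub_cancel_right, tadpoleTable_apply]
  have hper := isBlockPeriodic_tadpoleTable n a hn hWcov κ' l' (-z) u (x + (n : ℤ) • z)
  rw [tadpoleTable_apply, tadpoleTable_apply, smul_neg, show x + (n : ℤ) • z + -((n : ℤ) • z) = x by abel] at hper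
  rw [show (n : ℤ) • -z + u = u + -((n : ℤ) • z) by rw [smul_neg]; abel, hper]
  simp only [wK]
  ring

/-- [folklore] **THE WHOLE REDUCED ONE-SHOT KERNEL IS AN `ℋ`-SANDWICH OF THE FINE HESSIAN KERNEL**:
`TOfRed n a S (tableRed n Wf) μ ν z = dressedEntryP (wK n) (fineHess n a S Wf) (n•(−z)) μ ν`. -/
theorem TOfRed_tableRed_eq_dressedEntryP (hn : 1 ≤ n) (hGa : Spr (Ga n a)) (hS : ∀ κ' u, BiLoc (S κ' u) u u Cs δ)
    (hW : ∀ κ' u l' u', BiLoc (Wf κ' u l' u') u u' C2 δ) (hδ : 0 < δ)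
    (hScov : ∀ (κ' : Fin 4) (u v : Site 4), S κ' (u + v) = shiftK (-v) (S κ' u))
    (hWcov : ∀ (κ' : Fin 4) (u : Site 4) (l' : Fin 4) (u' v : Site 4), Wf κ' (u + v) l' (u' + v) = shiftK (-v) (Wf κ' u l' u'))
    (μ ν : Fin 4) (z : Site 4) :
    TOfRed n a S (tableRed n Wf) μ ν z = dressedEntryP (wK n) (fineHess n a S Wf) ((n : ℤ) • (-z)) μ ν := by
  have hadd := dressedEntryP_add (Nat.pos_of_ne_zero (NeZero.ne n)) (wK n) (tadpoleTable n a Wf) (bubbleTable n a S) absMoment₂_wK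
    (fun c e => isBlockPeriodic_tadpoleTable n a hn hWcov c e) (fun c e => isBlockPeriodic_bubbleTable n a hn hScov c e)
    (fun c e b => absMoment₂_baseKer_tadpoleTable n a hGa hW hδ c e b) (fun c e b => absMoment₂_baseKer_bubbleTable n a hGa hS hδ c e b)
    ((n : ℤ) • (-z)) μ ν
  rw [ReducedKernel.TOfRed_eq]
  show (1 / 2 : ℝ) * tadpole (Ga n a) (tableRed n Wf μ 0 ν z) - (1 / 2 : ℝ) * bubble (Ga n a) (vertexRed n S μ 0) (vertexRed n S ν z) = _
  rw [sub_eq_add_neg, ← neg_mul, tadpolePart_eq_dressedEntryP n a hn hGa hW hδ hWcov,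
    bubblePart_eq_dressedEntryP n a hn hGa hS hδ hScov, ← hadd]
  rfl

/-! ## §4 Composition with K-R5: no dressing cross term for the reduced kernel -/

/-- [folklore] **A4 — THE DRESSING CROSS TERMS OF THE REDUCED ONE-SHOT KERNEL VANISH.**  Reduced data: `S` self-localised and fine-translation
covariant, `Wf` bi-localised at its two fine bonds, jointly covariant and SYMMETRIC, `Spr (Ga n a)`, `n ≥ 1`.  GIVEN — hypotheses, the road's
Ward (A3.b) and parity (R5-(T1)) inputs for this piece — that every entry of `fineHess n a S Wf` has rows summing to zero and base-point-summed
first moments zero: the coarse BOND second moment of the reduced kernel, `Σ'_z z_κ z_λ · n⁸ · TOfRed n a S (tableRed n Wf) μ ν z`, EQUALS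
`avgM2 n (fineHess n a S Wf μ ν) κ λ` — the base-point average over one block of the fine second moment of the `(μ,ν)` entry of the explicit
fine Hessian kernel.  This is node R5's claim `secondMoment (ℋᵀ P ℋ) = ν(n)·Avg_b Σ_w w w P + X_n` with `X_n = 0`. -/
theorem bondSecondMoment_TOfRed_eq_avgM2 (hn : 1 ≤ n) (hGa : Spr (Ga n a)) (hS : ∀ κ' u, BiLoc (S κ' u) u u Cs δ)
    (hW : ∀ κ' u l' u', BiLoc (Wf κ' u l' u') u u' C2 δ) (hδ : 0 < δ)
    (hScov : ∀ (κ' : Fin 4) (u v : Site 4), S κ' (u + v) = shiftK (-v) (S κ' u))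
    (hWcov : ∀ (κ' : Fin 4) (u : Site 4) (l' : Fin 4) (u' v : Site 4), Wf κ' (u + v) l' (u' + v) = shiftK (-v) (Wf κ' u l' u'))
    (hWsymm : ∀ (κ' : Fin 4) (u : Site 4) (l' : Fin 4) (u' : Site 4), Wf κ' u l' u' = Wf l' u' κ' u)
    (hrow : ∀ (κ' l' : Fin 4) (b : Site 4), HasSum (fineHess n a S Wf κ' l' b) 0)
    (hT1 : ∀ (κ' l' μ' : Fin 4), ∑ r : Fin 4 → Fin n, ∑' t, (t μ' : ℝ) * baseKer (fineHess n a S Wf κ' l') (resSite r) t = 0)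
    (κ lam μ ν : Fin 4) :
    ∑' z : Site 4, ((z κ * z lam : ℤ) : ℝ) * ((n : ℝ) ^ 8 * TOfRed n a S (tableRed n Wf) μ ν z)
      = avgM2 n (fineHess n a S Wf μ ν) κ lam := by
  have hcol : ∀ (κ' l' : Fin 4) (b : Site 4), HasSum (fun s => fineHess n a S Wf κ' l' s b) 0 := fun κ' l' b =>
    (hrow l' κ' b).congr_fun fun s => fineHess_transpose n a hGa hS hδ hWsymm κ' l' s b
  have h := bondSecondMomentP_solutionOp_four (N := n) (fineHess n a S Wf) (isBlockPeriodic_fineHess n a hn hScov hWcov)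
    (absMoment₂_baseKer_fineHess n a hGa hS hW hδ) hcol hrow hT1 κ lam μ ν
  rw [← h, ← (Equiv.neg (Site 4)).tsum_eq]
  refine tsum_congr fun z => ?_
  rw [TOfRed_tableRed_eq_dressedEntryP n a hn hGa hS hW hδ hScov hWcov μ ν]
  simp only [Equiv.neg_apply, Pi.neg_apply, neg_mul_neg, neg_neg]

/-- [folklore] The same in `B12Beta.secondMoment` currency: `Σ'_z TOfRed … μ ν z · z_κ · z_λ = n⁻⁸ · avgM2 n (fineHess μ ν) κ λ`. -/
theorem secondMoment_TOfRed_eq (hn : 1 ≤ n) (hGa : Spr (Ga n a)) (hS : ∀ κ' u, BiLoc (S κ' u) u u Cs δ)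
    (hW : ∀ κ' u l' u', BiLoc (Wf κ' u l' u') u u' C2 δ) (hδ : 0 < δ)
    (hScov : ∀ (κ' : Fin 4) (u v : Site 4), S κ' (u + v) = shiftK (-v) (S κ' u))
    (hWcov : ∀ (κ' : Fin 4) (u : Site 4) (l' : Fin 4) (u' v : Site 4), Wf κ' (u + v) l' (u' + v) = shiftK (-v) (Wf κ' u l' u'))
    (hWsymm : ∀ (κ' : Fin 4) (u : Site 4) (l' : Fin 4) (u' : Site 4), Wf κ' u l' u' = Wf l' u' κ' u)
    (hrow : ∀ (κ' l' : Fin 4) (b : Site 4), HasSum (fineHess n a S Wf κ' l' b) 0)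
    (hT1 : ∀ (κ' l' μ' : Fin 4), ∑ r : Fin 4 → Fin n, ∑' t, (t μ' : ℝ) * baseKer (fineHess n a S Wf κ' l') (resSite r) t = 0)
    (κ lam μ ν : Fin 4) :
    ∑' z : Site 4, TOfRed n a S (tableRed n Wf) μ ν z * (z κ : ℝ) * (z lam : ℝ)
      = ((n : ℝ) ^ 8)⁻¹ * avgM2 n (fineHess n a S Wf μ ν) κ lam := by
  have hn' : (n : ℝ) ^ 8 ≠ 0 := pow_ne_zero 8 (by exact_mod_cast (show n ≠ 0 by omega))
  have h := bondSecondMoment_TOfRed_eq_avgM2 n a hn hGa hS hW hδ hScov hWcov hWsymm hrow hT1 κ lam μ ν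
  have e : (fun z : Site 4 => ((z κ * z lam : ℤ) : ℝ) * ((n : ℝ) ^ 8 * TOfRed n a S (tableRed n Wf) μ ν z))
      = fun z => (n : ℝ) ^ 8 * (TOfRed n a S (tableRed n Wf) μ ν z * (z κ : ℝ) * (z lam : ℝ)) := by
    funext z
    push_cast
    ring
  rw [e, tsum_mul_left] at h
  rw [← h, ← mul_assoc, inv_mul_cancel₀ hn', one_mul]

end Summit.QuantumFields.BalabanUV.Beta.D1BFx.ReducedKernelSandwich

end
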